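import Summits.QuantumFields.BalabanUV.Beta.GAN24.WilsonQuarticChargeWsym22Frames
import Summits.QuantumFields.BalabanUV.Beta.GAN24.WilsonBiStencilCornerSupport

/-!
# `BalabanUV.Beta.GAN24.WilsonQuarticChargeWsym22` — binder row G-an2-4 ∕ (CONV-C), W-slot CT-route, (C)_0 ∕ (C)sym level-0 kernel programme ((I)+(II)+(III)
# comparison, leaf-02's register), Part 2 of 2: **THE FULL FIELD–FIELD CHARGE TENSOR OF an3's SYMMETRISED TRACED WILSON TABLE `wsym22 N`, EVERY DIRECTION
# PATTERN** — `Σ'_{u′xz} wilsonW₂ d (wsym22 N) κ u κ′ u′ x z (inl α) (inl β) = −4N²·(2[κ=κ′][α=β] − [κ=β][κ′=α] − [κ=α][κ′=β])` — hence the cell charge `zmode` of the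
# normalised comb member `0` of the D1 literal in closed Kronecker form, plain and slot-symmetrised

NOT IN PRINT; OUR BOOKKEEPING (G-an2-4 crux team (2), leaf prover `b2b-balaban-gan24-formalise-leaf-02`, gen 63; journal INTENT I-leaf02-g63-1).  HONEST FRAMING
(cell contract, verbatim): «discharging `BetaPertH` makes Bałaban's UV stability UNCONDITIONAL — a real constructive-QFT result; it is NOT the continuum limit and NOT
the Clay problem.»  HONEST DEPENDENCY (verbatim): «continuum YM on T⁴ ⇐ BetaPertH ∧ nine spine estimates (0/9 proved); BetaPertH ⇐ (D1) ∧ (D4) ∧ CAP+tail; G-an2-4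
gates asym, D1 and NE2/3/4.»  [folklore] the frame sum of Part 1 (`WilsonQuarticChargeWsym22Frames`) through leaf-18 g16's `WilsonQuarticCharge.tsum_wilsonW₂_ff_eq`, an3's
`WilsonBiStencil.wilsonW₂_smul` and my g62 `WilsonBiStencilCornerSupport.zmode_memberZero_eq` BY NAME; generic `d`; 0 `def`, 0 cited facts, 0 `def … : Prop`, 0 sorry.
Discharges NOTHING of (C) ∕ (C)sym ∕ (Q-L) ∕ «T2Shape» ∕ «T2Drift» ∕ (hW, hWall); NEVER «G-an2-4 closed» as (CONV-C); NOT D1, NOT BetaPertH, NOT continuum, NOT Clay.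

## What
Known before (leaf-18 g16∕g17 `WilsonQuarticCharge(OffDiag)`, leaf-14 g24 `QuarticChargeSymTab` under an3's `symTab (w22 N) = wsym22 N`): the three NONZERO classes
`(κ,κ;α,α) ↦ −8N²`, `(κ,κ′;κ′,κ) ↦ 4N²`, `(κ,κ′;κ,κ′) ↦ 4N²` (`κ ≠ ·`).  NEW: the value on ALL `(d+1)⁴` patterns at once — the other thirteen two-direction classes and every
pattern with three or more directions carry NO charge — as ONE Kronecker polynomial, which is what a consumer quantifying over every pattern (the (C) row:
`RowCChargeForms.zsymMember_succ_eq_iff_rowC`, all `κ κ′ κ₁ κ₂`) needs.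
* §4 **`tsum_wilsonW₂_wsym22_ff`** — THE CHARGE TENSOR (every first bond `u`, every pattern, generic `d`):
  `∑' u′ x z, wilsonW₂ d (wsym22 N) κ u κ′ u′ x z (inl α) (inl β) = −4N²·((if κ = κ′ ∧ α = β then 2 else 0) − (if κ = β ∧ κ′ = α then 1 else 0) − (if κ = α ∧ κ′ = β then 1 else 0))`
  (the double frame sum: by cases on `κ = κ′`, `α = β`, parallel ∕ crossed, at most two frames survive — Part 1's sixteen values + its two vanishing lemmas);
  `chargePoly_swap` (the polynomial is symmetric under the background-slot swap `κ ↔ κ′`).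
* §5 CELL CHARGES: **`zmode_wilsonW₂_wsym22`** (`zmode N₀ (wilsonW₂ d (wsym22 N)) κ κ′ (inl α) (inl β) = N₀^{d+1}·(−4N²·P)`), `zmode_wilsonW₂_smul`, and THE
  INSTANCE THE (C)_0 ASSEMBLY READS: **`zmode_memberZero_wsym22`** — for the normalised comb member `T̃_0 = unitS₂ (sfStep Lc 0) (smStep d Lc 0) (T2RecAt d Lc ρ cE cVH cΛ cE₂ cB
  (c • wsym22 M) vh₂S mixFF 0)` (any root, any pins, any mixed table, ff-free border): `zmode N₀ T̃_0 μ ν (inl α) (inl β) = cE₂·c·(N₀^{d+1}·(−4M²·P(μ,ν;α,β)))`, and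
  **`zmodeSym_memberZero_wsym22`** (the slot-symmetrised charge is `2·` that).
READING (docstring level, not asserted): with leaf-04 g67's `RespWordsLevelZero.zmode_dressedSource_level0_an1_closed` ((I)+(II): `zmode Lc b̃_0 = C·(E+E′)` with the SAME
polynomial `E + E′ = P`) and my g62 `fourFace_memberZero_wsym22` ((III)), p2's balance `T2RecChargeStepFourFace.zmode_succ_eq_fourFace` at `j = 0`, `N := Lc` becomes ONE
scalar identity per pattern — the (C)_0 assembly (INTENT I-leaf02-g63-2, separate file `RowCLevelZero`).  2026-08-23; no existing file touched.
-/

noncomputable section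

open Finset
open scoped BigOperators
open Literature.MathematicalPhysics.QuantumFieldTheory
open Literature.MathematicalPhysics.QuantumFieldTheory.Balaban1983to89
open Literature.MathematicalPhysics.QuantumFieldTheory.Balaban1983to89.Beta
open OneStepResolventKernel (Fib)
open AffineAveraging (box toSite Site)
open PlaquetteVertex2Stencil (dir)
open WilsonVertex2Sym (wsym22)
open WilsonBiStencil (wilsonW₂ wilsonW₂_smul)
open Summit.QuantumFields.BalabanUV.Beta.SecondOrderUnits (unitS₂)
open Summit.QuantumFields.BalabanUV.Beta.SpineRooted (T2RecAt)
open Summit.QuantumFields.BalabanUV.Beta.GAN24.CombesThomas (sfStep smStep)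
open Summit.QuantumFields.BalabanUV.Beta.GAN24.BiStencilZeroMode (Tab zmode)
open Summit.QuantumFields.BalabanUV.Beta.GAN24.WilsonQuarticCharge (tsum_wilsonW₂_ff_eq)
open Summit.QuantumFields.BalabanUV.Beta.GAN24.WilsonBiStencilCornerSupport (zmode_memberZero_eq)
open Summit.QuantumFields.BalabanUV.Beta.GAN24.WilsonQuarticChargeWsym22Frames

namespace Summit.QuantumFields.BalabanUV.Beta.GAN24.WilsonQuarticChargeWsym22

variable {d : ℕ}

/-! ## §4 The charge tensor on every pattern -/

/-- NOT IN PRINT; OUR BOOKKEEPING ([folklore] frame sum of §2–§3).  **THE FIELD–FIELD CHARGE TENSOR OF an3's SYMMETRISED TRACED WILSON TABLE, EVERY PATTERN**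
(every first bond `u`, generic `d`): `Σ'_{u′xz} wilsonW₂ d (wsym22 N) κ u κ′ u′ x z (inl α) (inl β) = −4N²·(2[κ=κ′][α=β] − [κ=β][κ′=α] − [κ=α][κ′=β])` — the three
charged classes are `(κ,κ;α,α) ↦ −8N²`, `(κ,κ′;κ′,κ) ↦ 4N²`, `(κ,κ′;κ,κ′) ↦ 4N²` (`κ ≠ ·`; leaf-14's values BY a different route), all other patterns carry NO charge. -/
theorem tsum_wilsonW₂_wsym22_ff (N : ℕ) (κ : Fin (d + 1)) (u : Fin (d + 1) → ℤ) (κ' α β : Fin (d + 1)) :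
    ∑' u' : Fin (d + 1) → ℤ, ∑' x : Fin (d + 1) → ℤ, ∑' z : Fin (d + 1) → ℤ,
        wilsonW₂ d (wsym22 N) κ u κ' u' x z (Sum.inl α) (Sum.inl β)
      = -4 * (N : ℝ) ^ 2 * ((if κ = κ' ∧ α = β then 2 else 0) - (if κ = β ∧ κ' = α then 1 else 0) - (if κ = α ∧ κ' = β then 1 else 0)) := by
  rw [tsum_wilsonW₂_ff_eq, ← Fintype.sum_prod_type' (f := fun μ ν => ∑ k : Fin 4, ∑ l : Fin 4, if dir μ ν k = κ ∧ dir μ ν l = κ' then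
        ∑ i : Fin 4, ∑ j : Fin 4, (if α = dir μ ν i ∧ β = dir μ ν j then wsym22 N i j k l else 0) else 0)]
  by_cases hκ : κ = κ'
  · subst hκ
    by_cases hαβ : α = β
    · subst hαβ
      by_cases hκα : κ = α
      · -- all four directions equal: every frame vanishes
        subst hκα
        rw [Finset.sum_eq_zero]
        · norm_num
        · rintro ⟨μ, ν⟩ -
          dsimp only
          by_cases hμν : μ = ν
          · subst hμν; exact frame_wsym22_diag N μ κ κ κ κ
          · by_cases h1 : κ = μ
            · subst h1; exact frame_wsym22_mmmm N hμν
            · by_cases h2 : κ = ν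
              · subst h2; exact frame_wsym22_nnnn N hμν
              · exact frame_eq_zero_of_not_mem _ fun h => h.1.elim h1 h2
      · -- `(κ,κ;α,α)`, `κ ≠ α`: the two frames `(κ,α)`, `(α,κ)`, `−4N²` each
        rw [Finset.sum_eq_add_of_mem (κ, α) (α, κ) (Finset.mem_univ _) (Finset.mem_univ _)
          (fun h => hκα (Prod.ext_iff.mp h).1)]
        · dsimp only
          rw [frame_wsym22_mmnn N hκα, frame_wsym22_nnmm N (Ne.symm hκα)]
          simp only [and_self, if_true, hκα, if_false]
          ring
        · rintro ⟨μ, ν⟩ - ⟨hne1, hne2⟩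
          dsimp only
          by_cases hμν : μ = ν
          · subst hμν; exact frame_wsym22_diag N μ κ κ α α
          · refine frame_eq_zero_of_not_mem _ ?_
            rintro ⟨hk, -, ha, -⟩
            rcases hk with rfl | rfl <;> rcases ha with rfl | rfl
            · exact hκα rfl
            · exact hne1 rfl
            · exact hne2 rfl
            · exact hκα rfl
    · -- `κ = κ'`, `α ≠ β`: every frame vanishes
      rw [Finset.sum_eq_zero]
      · have e1 : ¬(κ = β ∧ κ = α) := fun h => hαβ (h.2.symm.trans h.1)
        have e2 : ¬(κ = α ∧ κ = β) := fun h => hαβ (h.1.symm.trans h.2)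
        simp [hαβ, e1, e2]
      · rintro ⟨μ, ν⟩ -
        dsimp only
        by_cases hμν : μ = ν
        · subst hμν; exact frame_wsym22_diag N μ κ κ α β
        · by_cases hm : (κ = μ ∨ κ = ν) ∧ (κ = μ ∨ κ = ν) ∧ (α = μ ∨ α = ν) ∧ (β = μ ∨ β = ν)
          · obtain ⟨hk, -, ha, hb⟩ := hm
            rcases hk with rfl | rfl <;> rcases ha with rfl | rfl <;> rcases hb with rfl | rfl
            · exact absurd rfl hαβ
            · exact frame_wsym22_mmmn N hμν
            · exact frame_wsym22_mmnm N hμν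
            · exact absurd rfl hαβ
            · exact absurd rfl hαβ
            · exact frame_wsym22_nnmn N hμν
            · exact frame_wsym22_nnnm N hμν
            · exact absurd rfl hαβ
          · exact frame_eq_zero_of_not_mem _ hm
  · by_cases hαβ : α = β
    · -- `κ ≠ κ'`, `α = β`: every frame vanishes
      subst hαβ
      rw [Finset.sum_eq_zero]
      · have e1 : ¬(κ = α ∧ κ' = α) := fun h => hκ (h.1.trans h.2.symm)
        simp [hκ, e1]
      · rintro ⟨μ, ν⟩ -
        dsimp only
        by_cases hμν : μ = ν
        · subst hμν; exact frame_wsym22_diag N μ κ κ' α α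
        · by_cases hm : (κ = μ ∨ κ = ν) ∧ (κ' = μ ∨ κ' = ν) ∧ (α = μ ∨ α = ν) ∧ (α = μ ∨ α = ν)
          · obtain ⟨hk, hk', ha, -⟩ := hm
            rcases hk with rfl | rfl <;> rcases hk' with rfl | rfl <;> rcases ha with rfl | rfl
            · exact absurd rfl hκ
            · exact absurd rfl hκ
            · exact frame_wsym22_mnmm N hμν
            · exact frame_wsym22_mnnn N hμν
            · exact frame_wsym22_nmmm N hμν
            · exact frame_wsym22_nmnn N hμν
            · exact absurd rfl hκ
            · exact absurd rfl hκ
          · exact frame_eq_zero_of_not_mem _ hm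
    · by_cases hpar : κ = α ∧ κ' = β
      · -- parallel `(κ,κ';κ,κ')`: frames `(κ,κ')`, `(κ',κ)`, `+2N²` each
        obtain ⟨rfl, rfl⟩ := hpar
        rw [Finset.sum_eq_add_of_mem (κ, κ') (κ', κ) (Finset.mem_univ _) (Finset.mem_univ _)
          (fun h => hκ (Prod.ext_iff.mp h).1)]
        · dsimp only
          rw [frame_wsym22_mnmn N hκ, frame_wsym22_nmnm N (Ne.symm hκ)]
          simp only [hκ, false_and, if_false, and_self, if_true]
          ring
        · rintro ⟨μ, ν⟩ - ⟨hne1, hne2⟩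
          dsimp only
          by_cases hμν : μ = ν
          · subst hμν; exact frame_wsym22_diag N μ κ κ' κ κ'
          · refine frame_eq_zero_of_not_mem _ ?_
            rintro ⟨hk, hk', -, -⟩
            rcases hk with rfl | rfl <;> rcases hk' with rfl | rfl
            · exact hκ rfl
            · exact hne1 rfl
            · exact hne2 rfl
            · exact hκ rfl
      · by_cases hcr : κ = β ∧ κ' = α
        · -- crossed `(κ,κ';κ',κ)`: frames `(κ,κ')`, `(κ',κ)`, `+2N²` each
          obtain ⟨rfl, rfl⟩ := hcr
          rw [Finset.sum_eq_add_of_mem (κ, κ') (κ', κ) (Finset.mem_univ _) (Finset.mem_univ _)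
            (fun h => hκ (Prod.ext_iff.mp h).1)]
          · dsimp only
            rw [frame_wsym22_mnnm N hκ, frame_wsym22_nmmn N (Ne.symm hκ)]
            simp only [hκ, false_and, if_false, and_self, if_true]
            ring
          · rintro ⟨μ, ν⟩ - ⟨hne1, hne2⟩
            dsimp only
            by_cases hμν : μ = ν
            · subst hμν; exact frame_wsym22_diag N μ κ κ' κ' κ
            · refine frame_eq_zero_of_not_mem _ ?_
              rintro ⟨hk, hk', -, -⟩
              rcases hk with rfl | rfl <;> rcases hk' with rfl | rfl
              · exact hκ rfl
              · exact hne1 rfl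
              · exact hne2 rfl
              · exact hκ rfl
        · -- `κ ≠ κ'`, `α ≠ β`, `{α,β} ≠ {κ,κ'}`: every frame vanishes
          rw [Finset.sum_eq_zero]
          · simp [hκ, hpar, hcr]
          · rintro ⟨μ, ν⟩ -
            dsimp only
            by_cases hμν : μ = ν
            · subst hμν; exact frame_wsym22_diag N μ κ κ' α β
            · refine frame_eq_zero_of_not_mem _ ?_
              rintro ⟨hk, hk', ha, hb⟩
              rcases hk with rfl | rfl <;> rcases hk' with rfl | rfl
              · exact hκ rfl
              · rcases ha with rfl | rfl <;> rcases hb with rfl | rfl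
                · exact hαβ rfl
                · exact hpar ⟨rfl, rfl⟩
                · exact hcr ⟨rfl, rfl⟩
                · exact hαβ rfl
              · rcases ha with rfl | rfl <;> rcases hb with rfl | rfl
                · exact hαβ rfl
                · exact hcr ⟨rfl, rfl⟩
                · exact hpar ⟨rfl, rfl⟩
                · exact hαβ rfl
              · exact hκ rfl

/-- [folklore] the charge polynomial is symmetric under the background-slot swap `κ ↔ κ′`. -/
theorem chargePoly_swap (N : ℕ) (κ κ' α β : Fin (d + 1)) :
    -4 * (N : ℝ) ^ 2 * ((if κ' = κ ∧ α = β then 2 else 0) - (if κ' = β ∧ κ = α then 1 else 0) - (if κ' = α ∧ κ = β then 1 else 0))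
      = -4 * (N : ℝ) ^ 2 * ((if κ = κ' ∧ α = β then 2 else 0) - (if κ = β ∧ κ' = α then 1 else 0) - (if κ = α ∧ κ' = β then 1 else 0)) := by
  have e1 : (κ' = κ ∧ α = β) ↔ (κ = κ' ∧ α = β) := by rw [eq_comm]
  have e2 : (κ' = β ∧ κ = α) ↔ (κ = α ∧ κ' = β) := and_comm
  have e3 : (κ' = α ∧ κ = β) ↔ (κ = β ∧ κ' = α) := and_comm
  simp only [e1, e2, e3]
  ring

/-! ## §5 Cell charges: `zmode` of the symmetrised Wilson family and of the literal's normalised comb member `0` -/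

/-- [folklore] **THE CELL CHARGE OF `wilsonW₂ d (wsym22 N)` AT PERIOD `N₀`, EVERY PATTERN**: `N₀^{d+1}` copies of the per-bond tensor of §4. -/
theorem zmode_wilsonW₂_wsym22 (N₀ N : ℕ) (κ κ' α β : Fin (d + 1)) :
    zmode N₀ (wilsonW₂ d (wsym22 N)) κ κ' (Sum.inl α) (Sum.inl β)
      = (N₀ : ℝ) ^ (d + 1) * (-4 * (N : ℝ) ^ 2 *
          ((if κ = κ' ∧ α = β then 2 else 0) - (if κ = β ∧ κ' = α then 1 else 0) - (if κ = α ∧ κ' = β then 1 else 0))) := by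
  have hcard : (box (d + 1) N₀).card = N₀ ^ (d + 1) := by
    simp [AffineAveraging.box, Fintype.card_piFinset]
  unfold zmode
  simp_rw [tsum_wilsonW₂_wsym22_ff]
  rw [Finset.sum_const, hcard, nsmul_eq_mul, Nat.cast_pow]

/-- [folklore] the cell charge is homogeneous in the position table. -/
theorem zmode_wilsonW₂_smul (N₀ : ℕ) (c : ℝ) (T : Fin 4 → Fin 4 → Fin 4 → Fin 4 → ℝ) (κ κ' : Fin (d + 1)) (a b : Fib d) :
    zmode N₀ (wilsonW₂ d (c • T)) κ κ' a b = c * zmode N₀ (wilsonW₂ d T) κ κ' a b := by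
  unfold zmode
  simp_rw [wilsonW₂_smul, Pi.smul_apply, smul_eq_mul, tsum_mul_left]
  rw [← Finset.mul_sum]

section MemberZero

variable {Lc : ℕ} [NeZero Lc]

/-- NOT IN PRINT; OUR BOOKKEEPING.  **THE CELL CHARGE OF THE D1 LITERAL's NORMALISED COMB MEMBER `0`, EVERY PATTERN, CLOSED FORM** (`T̃_0 = unitS₂ (sfStep Lc 0)
(smStep d Lc 0) (T2RecAt d Lc ρ cE cVH cΛ cE₂ cB (c • wsym22 M) vh₂S mixFF 0)`, any root ∕ pins ∕ mixed table, ff-free border `hBff`; my g62 `zmode_memberZero_eq` × §4):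
`zmode N₀ T̃_0 μ ν (inl α) (inl β) = cE₂·c·(N₀^{d+1}·(−4M²·(2[μ=ν][α=β] − [μ=β][ν=α] − [μ=α][ν=β])))`. -/
theorem zmode_memberZero_wsym22 (N₀ : ℕ) (cE cVH cΛ cE₂ cB c : ℝ) (M : ℕ) (ρ : Fin (d + 1) → ℤ) {vh₂S mixFF : Tab d}
    (hBff : ∀ κ u κ' u' x z (α β : Fin (d + 1)), vh₂S κ u κ' u' x z (Sum.inl α) (Sum.inl β) = 0) (μ ν α β : Fin (d + 1)) :
    zmode N₀ (unitS₂ (sfStep Lc 0) (smStep d Lc 0) (T2RecAt d Lc ρ cE cVH cΛ cE₂ cB (c • wsym22 M) vh₂S mixFF 0)) μ ν (Sum.inl α) (Sum.inl β)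
      = cE₂ * c * ((N₀ : ℝ) ^ (d + 1) * (-4 * (M : ℝ) ^ 2 *
          ((if μ = ν ∧ α = β then 2 else 0) - (if μ = β ∧ ν = α then 1 else 0) - (if μ = α ∧ ν = β then 1 else 0)))) := by
  rw [zmode_memberZero_eq N₀ cE cVH cΛ cE₂ cB (c • wsym22 M) ρ hBff, zmode_wilsonW₂_smul, zmode_wilsonW₂_wsym22]
  ring

/-- NOT IN PRINT; OUR BOOKKEEPING.  **THE SLOT-SYMMETRISED CELL CHARGE OF MEMBER `0`** (`zmodeSym_{N₀} (T̃_0)(μ,ν;α,β) := zmode (μ,ν) + zmode (ν,μ)`): twice the plain one —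
the polynomial of §4 is slot-symmetric (`chargePoly_swap`). -/
theorem zmodeSym_memberZero_wsym22 (N₀ : ℕ) (cE cVH cΛ cE₂ cB c : ℝ) (M : ℕ) (ρ : Fin (d + 1) → ℤ) {vh₂S mixFF : Tab d}
    (hBff : ∀ κ u κ' u' x z (α β : Fin (d + 1)), vh₂S κ u κ' u' x z (Sum.inl α) (Sum.inl β) = 0) (μ ν α β : Fin (d + 1)) :
    zmode N₀ (unitS₂ (sfStep Lc 0) (smStep d Lc 0) (T2RecAt d Lc ρ cE cVH cΛ cE₂ cB (c • wsym22 M) vh₂S mixFF 0)) μ ν (Sum.inl α) (Sum.inl β)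
      + zmode N₀ (unitS₂ (sfStep Lc 0) (smStep d Lc 0) (T2RecAt d Lc ρ cE cVH cΛ cE₂ cB (c • wsym22 M) vh₂S mixFF 0)) ν μ (Sum.inl α) (Sum.inl β)
      = 2 * (cE₂ * c * ((N₀ : ℝ) ^ (d + 1) * (-4 * (M : ℝ) ^ 2 *
          ((if μ = ν ∧ α = β then 2 else 0) - (if μ = β ∧ ν = α then 1 else 0) - (if μ = α ∧ ν = β then 1 else 0))))) := by
  rw [zmode_memberZero_wsym22 N₀ cE cVH cΛ cE₂ cB c M ρ hBff μ ν α β, zmode_memberZero_wsym22 N₀ cE cVH cΛ cE₂ cB c M ρ hBff ν μ α β,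
    chargePoly_swap M μ ν α β]
  ring

end MemberZero

end Summit.QuantumFields.BalabanUV.Beta.GAN24.WilsonQuarticChargeWsym22

end
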